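import Summits.AnomalousDissipation.AnomalousDissipation.Theses.WazewskiBlock
import Literature.Analysis.FluidPDE.NSGalerkinTrajectory

/-!
# Route `WazewskiBlock`, item stmt-AnomalousDissipation-10354 (`SubLaminarThreeDTrapAtOneViscosity`):
# reduction to N-uniform steady Galerkin states

The route decl asks, at ONE viscosity and for the Kolmogorov force `F sin(2π m x₁) e₀`, for a global
Galerkin trajectory of every large order `N` that is mean-zero, keeps a transverse-energy floor
`∫ U₂² ≥ δ`, and stays in `{kineticEnergy ≤ E, (f,U) ≥ ε₀, ‖∇U‖² ≤ G}` with `E` strictly below the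
laminar energy. This file proves the (elementary) reduction used by the intended witnesses — tilted
2.5-D secondary STEADY states of 3-D Kolmogorov flow (`m = 2`), see the item's evidence note:

* `isGalerkinTrajectory_const_of_steady` — a steady Galerkin state of order `N` (a Galerkin mode `u`
  satisfying the tested steady Galerkin equations and the steady energy equation `ν‖∇u‖² = (f,u)`)
  is, as the constant curve `t ↦ u`, a global Galerkin trajectory of order `N`
  (`Literature.Analysis.FluidPDE.Torus.IsGalerkinTrajectory`: joint continuity, Galerkin-mode and
  weakly divergence-free slices, time-integrated tested Galerkin equations, exact energy identity).
* `subLaminarThreeDTrap_of_steadyStates` — hence an `N`-uniform family of such steady states obeying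
  the four bounds (with `E` below the laminar energy) proves `SubLaminarThreeDTrapAtOneViscosity`.

What remains for the item is therefore finite-dimensional: for all `N ≥ N₀`, a zero of the order-`N`
Galerkin vector field with the four `N`-uniform bounds (programme D1–D5 in the prover's notes:
Brouwer-degree parity at the laminar state in the oblique symmetry class).
-/

noncomputable section

-- `Summit.<Summit>.<Problem>` is the tree's mandated summit-side namespace (CONVENTIONS §2); deliberate duplicate.
set_option linter.dupNamespace false

open scoped InnerProductSpace
open MeasureTheory Set UnitAddTorus
open Literature.Analysis.FunctionSpaces Literature.Analysis.FunctionSpaces.Torus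
open Literature.Analysis.FluidPDE

namespace Summit.AnomalousDissipation.AnomalousDissipation.Theorems

/-- **A steady Galerkin state is a (constant) global Galerkin trajectory.** If `u` is a Galerkin mode
of order `N` on `T^d` satisfying the tested steady Galerkin equations
`∫ (⟪u, (u·∇)a⟫ + ν⟪u, Δa⟫ + ⟪f, a⟫) = 0` against every Galerkin mode `a` of order `N` and the steady
energy equation `ν ‖∇u‖² = ∫ ⟪f, u⟫`, then `t ↦ u` is a global Galerkin trajectory of order `N` with
the steady force `f`: the time-integrated Galerkin identity has both sides `0`, and the energy
identity reads `E + ν (t - s) ‖∇u‖² = E + (t - s) (f, u)`. [folklore] -/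
theorem isGalerkinTrajectory_const_of_steady {d : Type*} [Fintype d] [DecidableEq d] {ν : ℝ}
    {f : UnitAddTorus d → EuclideanSpace ℝ d} {N : ℕ} {u : UnitAddTorus d → EuclideanSpace ℝ d}
    (hu : IsGalerkinMode N u)
    (hsteady : ∀ a : UnitAddTorus d → EuclideanSpace ℝ d, IsGalerkinMode N a →
      ∫ x, (⟪u x, convect u a x⟫_ℝ + ν * ⟪u x, laplacian a x⟫_ℝ + ⟪f x, a x⟫_ℝ) = 0)
    (henergy : ν * (eGradNormSq u).toReal = ∫ x, ⟪f x, u x⟫_ℝ) :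
    Torus.IsGalerkinTrajectory ν f N (fun _ : ℝ => u) := by
  refine Torus.IsGalerkinTrajectory.of_isGalerkinMode ?_ (fun _ _ => hu) ?_ ?_
  · -- joint continuity of the constant-in-time lift
    have hc : Continuous (stLift (fun _ : ℝ => u)) :=
      (hu.isSmooth.continuous.comp continuous_proj).comp continuous_snd
    exact hc.continuousOn
  · -- tested Galerkin equations, integrated in time: `0 = ∫ₛᵗ 0`
    intro a ha s t _ _
    simp only [sub_self, hsteady a ha, intervalIntegral.integral_zero]
  · -- exact energy identity from the steady energy equation
    intro s t _ hst
    have hvol : (volume (Ioo s t)) = ENNReal.ofReal (t - s) := Real.volume_Ioo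
    rw [setLIntegral_const, hvol, ENNReal.toReal_mul, ENNReal.toReal_ofReal (sub_nonneg.2 hst),
      intervalIntegral.integral_const, smul_eq_mul, ← henergy]
    ring

/-- **Reduction of `SubLaminarThreeDTrapAtOneViscosity` to `N`-uniform steady Galerkin states.**
If for some `m ≥ 1`, `ν > 0`, `F`, an energy level `E < F²/(4ν²(2πm)⁴)` (the laminar energy),
`ε₀, δ > 0`, `G` and `N₀` every order `N ≥ N₀` carries a STEADY Galerkin state `u` (Galerkin mode of
order `N`, tested steady Galerkin equations for the Kolmogorov force `F sin(2π m x₁) e₀`, steady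
energy equation) which is mean-zero with `∫ u₂² ≥ δ`, `kineticEnergy u ≤ E`, `(f, u) ≥ ε₀` and
`‖∇u‖² ≤ G`, then the route decl holds (constant trajectories,
`isGalerkinTrajectory_const_of_steady`). [folklore] -/
theorem subLaminarThreeDTrap_of_steadyStates
    (h : ∃ (m : ℕ) (F ν E ε₀ δ : ℝ) (G : NNReal) (N₀ : ℕ), 0 < m ∧ 0 < ν ∧ 0 < ε₀ ∧ 0 < δ ∧
      E < F ^ 2 / (4 * ν ^ 2 * (2 * Real.pi * m) ^ 4) ∧
      ∀ N : ℕ, N₀ ≤ N → ∃ u : UnitAddTorus (Fin 3) → EuclideanSpace ℝ (Fin 3),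
        IsGalerkinMode N u ∧ HasZeroMean u ∧
        (∀ a : UnitAddTorus (Fin 3) → EuclideanSpace ℝ (Fin 3), IsGalerkinMode N a →
          ∫ x, (⟪u x, convect u a x⟫_ℝ + ν * ⟪u x, laplacian a x⟫_ℝ +
            ⟪((fun x : UnitAddTorus (Fin 3) => ((F * (mFourier (Pi.single (1 : Fin 3) (m : ℤ)) x).im) •
              EuclideanSpace.single (0 : Fin 3) (1 : ℝ) : EuclideanSpace ℝ (Fin 3))) x), a x⟫_ℝ) = 0) ∧
        ν * (eGradNormSq u).toReal =
          ∫ x, ⟪((fun x : UnitAddTorus (Fin 3) => ((F * (mFourier (Pi.single (1 : Fin 3) (m : ℤ)) x).im) •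
              EuclideanSpace.single (0 : Fin 3) (1 : ℝ) : EuclideanSpace ℝ (Fin 3))) x), u x⟫_ℝ ∧
        δ ≤ ∫ x, (u x 2) ^ 2 ∧ kineticEnergy u ≤ E ∧
        ε₀ ≤ ∫ x, ⟪((fun x : UnitAddTorus (Fin 3) => ((F * (mFourier (Pi.single (1 : Fin 3) (m : ℤ)) x).im) •
              EuclideanSpace.single (0 : Fin 3) (1 : ℝ) : EuclideanSpace ℝ (Fin 3))) x), u x⟫_ℝ ∧
        eGradNormSq u ≤ (G : ENNReal)) :
    Summit.AnomalousDissipation.AnomalousDissipation.Theses.WazewskiBlock.SubLaminarThreeDTrapAtOneViscosity := by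
  obtain ⟨m, F, ν, E, ε₀, δ, G, N₀, hm, hν, hε₀, hδ, hE, hN⟩ := h
  refine ⟨m, F, ν, E, ε₀, δ, G, N₀, hm, hν, hε₀, hδ, hE, fun N hNN => ?_⟩
  obtain ⟨u, hu, hmean, hsteady, henergy, hfloor, hKE, hwork, hgrad⟩ := hN N hNN
  have htraj := isGalerkinTrajectory_const_of_steady hu hsteady henergy
  exact ⟨fun _ => u, ⟨htraj.continuousOn, fun t ht => ⟨htraj.isGalerkinMode t ht, htraj.isWeaklyDivFree t ht⟩,
    htraj.galerkin, htraj.energy_eq⟩, fun _ _ => ⟨hmean, hfloor⟩, fun _ _ => ⟨hKE, hwork, hgrad⟩⟩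

end Summit.AnomalousDissipation.AnomalousDissipation.Theorems

end
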